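import Summits.Ventures.LatticeQCDFlow.TrivializingMaps.HaarFibreAverages

/-!
HONEST FRAMING: exact (Metropolis-corrected) sampling algorithms for lattice gauge theory; figures
of merit are autocorrelation/cost numbers at stated couplings and volumes; no continuum-physics
claim.

# GibbsFibreVariance — THE ONE-LINK STEP: ALONG A HAAR FIBRE THE TILTED SECOND MOMENT OF `S` SPLITS
# INTO `e^{-|t|B} ×` THE HAAR FIBRE VARIANCE OF THE LINK-LOCAL PART PLUS A RE-CENTRED SECOND MOMENT
# (conditional-variance / finite-energy mechanism, every compact gauge group; lean-2 GEN-9, ours)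

Venture-side (OURS).  Cell `lqcd-flow` (pub-lqcd), unit `pub-lqcd-lean-2-g9`, 2026-08-22.  The heart of
the `β ≠ 0` EXTENSIVE VARIANCE FLOOR of the Wilson action (sequels `GibbsVarianceFloor`,
`WilsonVarianceFloorAllCouplings`): no cluster expansion, no sign control of Wilson loops — only the law
of total variance along single-link Haar fibres of `D[U] = ⊗_links Haar` and the boundedness of the local
energy ("finite energy").  Notation of `HaarFibreAverages` (`D`, `ν`, `h ·_e U`).

* `exp_neg_mul_ge_exp_mul_integral` — `osc g ≤ B ⇒ e^{-t g(y)} ≥ e^{-|t|B} ∫ e^{-tg} dμ` pointwise;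
  `variance_le_integral_sq_sub` — `Var_μ(g) ≤ ∫ (g − a)² dμ`;
* `fibre_sq_integral_ge` — the tilted one-variable inequality
  `∫ (F + K)² e^{-tF} dν ≥ e^{-|t|B}·Z·Var_ν(F) + Z·(m + K)²` (`Z = ∫ e^{-tF} dν`, `m` the tilted mean);
* `continuous_fibreTiltMean`, `fibreTiltMean_invariant` — the tilted fibre mean `m_e(U)` is continuous
  and invariant along every other fibre along which `f` is;
* **`one_link_step`** — if `S = f + r` with `r` and `c` invariant along the `e`-fibre and `osc f ≤ B`:
  `e^{-|t|B} ∫ e^{-tS} Var_ν[h ↦ f(h ·_e U)] dD(U) + ∫ (S − c')² e^{-tS} dD ≤ ∫ (S − c)² e^{-tS} dD`,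
  `c' = f + c − m_e` (again continuous and suitably invariant, so the step can be iterated: sequel).

NOT CLAIMED: any evaluation of the fibre variances (the Wilson sequels); optimal constants.
Literature grade (cell rule): known mechanism (law of total variance on a sublattice / finite-energy
bounds, e.g. Dobrushin–Tirozzi 1977 for lattice systems); new typing for lattice gauge theory, no new
theorem of physics.
-/

noncomputable section

open MeasureTheory ProbabilityTheory Filter Topology Set
open Literature.MathematicalPhysics.QuantumFieldTheory
open Literature.MathematicalPhysics.QuantumFieldTheory.Luscher2010

namespace Summit.Ventures.LatticeQCDFlow.TrivializingMaps

variable {d L : ℕ} [NeZero L] {G : Type*} [Group G] [TopologicalSpace G] [IsTopologicalGroup G]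
  [CompactSpace G] [MeasurableSpace G] [BorelSpace G] [SecondCountableTopology G]

/-! ## §2 The one-link step -/

section OneLink

/-- **Pointwise domination of a tilting weight by its mean**: if `|g y − g y'| ≤ B` for all `y, y'` then
`e^{-t g(y)} ≥ e^{-|t| B} ∫ e^{-t g} dμ` for every `y` (`μ` a probability measure). [folklore] -/
theorem exp_neg_mul_ge_exp_mul_integral {Y : Type*} [MeasurableSpace Y] (μ : Measure Y)
    [IsProbabilityMeasure μ] {g : Y → ℝ} {B t : ℝ} (hB : ∀ y y', g y - g y' ≤ B) (y : Y) :
    Real.exp (-(|t| * B)) * ∫ y', Real.exp (-(t * g y')) ∂μ ≤ Real.exp (-(t * g y)) := by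
  have hpt : ∀ y', Real.exp (-(|t| * B)) * Real.exp (-(t * g y')) ≤ Real.exp (-(t * g y)) := by
    intro y'
    rw [← Real.exp_add]
    refine Real.exp_le_exp.2 ?_
    -- `t (g y − g y') ≤ |t| B`
    have h1 := hB y y'
    have h2 := hB y' y
    rcases le_or_gt 0 t with ht | ht
    · rw [abs_of_nonneg ht]; nlinarith
    · rw [abs_of_neg ht]; nlinarith
  calc Real.exp (-(|t| * B)) * ∫ y', Real.exp (-(t * g y')) ∂μ
      = ∫ y', Real.exp (-(|t| * B)) * Real.exp (-(t * g y')) ∂μ := (integral_const_mul _ _).symm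
    _ ≤ ∫ _y', Real.exp (-(t * g y)) ∂μ := by
        refine integral_mono_of_nonneg (ae_of_all _ fun y' => by positivity) (integrable_const _)
          (ae_of_all _ fun y' => hpt y')
    _ = Real.exp (-(t * g y)) := by rw [integral_const, smul_eq_mul, probReal_univ, one_mul]

/-- **Second moment about any constant dominates the variance** (probability measure, `g` bounded
continuous on a compact space): `Var_μ(g) ≤ ∫ (g − a)² dμ`. [folklore] -/
theorem variance_le_integral_sq_sub {Y : Type*} [TopologicalSpace Y] [CompactSpace Y]
    [MeasurableSpace Y] [OpensMeasurableSpace Y] (μ : Measure Y) [IsProbabilityMeasure μ]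
    {g : Y → ℝ} (hg : Continuous g) (a : ℝ) :
    variance g μ ≤ ∫ y, (g y - a) ^ 2 ∂μ := by
  have hint : Integrable g μ := (BoundedContinuousFunction.mkOfCompact ⟨g, hg⟩).integrable _
  set M : ℝ := ∫ y, g y ∂μ with hM
  have hint2 : Integrable (fun y => (g y - M) ^ 2) μ :=
    (BoundedContinuousFunction.mkOfCompact ⟨_, (hg.sub continuous_const).pow 2⟩).integrable _
  have hint3 : Integrable (fun y => 2 * (M - a) * (g y - M)) μ :=
    (hint.sub (integrable_const M)).const_mul (2 * (M - a))
  rw [variance_eq_integral hg.aemeasurable]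
  have hfun : (fun y => (g y - a) ^ 2) =
      fun y => ((g y - M) ^ 2 + 2 * (M - a) * (g y - M)) + (M - a) ^ 2 := by
    funext y; ring
  have hint23 : Integrable (fun y => (g y - M) ^ 2 + 2 * (M - a) * (g y - M)) μ := hint2.add hint3
  rw [hfun, integral_add hint23 (integrable_const _), integral_add hint2 hint3,
    integral_const_mul, integral_sub hint (integrable_const M), integral_const, integral_const]
  simp only [smul_eq_mul, probReal_univ, one_mul]
  rw [← hM]
  nlinarith [sq_nonneg (M - a)]

variable [DecidableEq (Edge d L)]

omit [NeZero L] [SecondCountableTopology G] in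
/-- **The tilted fibre law along one link** (pointwise in `U`): with `F(h) = f(h ·_e U)`, `w = e^{-tF}`,
`Z = ∫ w dν`, `m = (∫ F w dν)/Z` and `osc f ≤ B`:
`∫ (F + K)² w dν ≥ e^{-|t|B} · Z · Var_ν(F) + Z · (m + K)²` for every constant `K`. [ours] -/
theorem fibre_sq_integral_ge (e : Edge d L) (t B K : ℝ) {f : GaugeConfig d L G → ℝ}
    (hf : Continuous f) (hB : ∀ U V, f U - f V ≤ B) (U : GaugeConfig d L G) :
    let ν := haarProbability G
    let F : G → ℝ := fun h => f (Pi.mulSingle e h * U)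
    let Z : ℝ := ∫ h, Real.exp (-(t * F h)) ∂ν
    let m : ℝ := (∫ h, F h * Real.exp (-(t * F h)) ∂ν) / Z
    Real.exp (-(|t| * B)) * Z * variance F ν + Z * (m + K) ^ 2 ≤
      ∫ h, (F h + K) ^ 2 * Real.exp (-(t * F h)) ∂ν := by
  intro ν F Z m
  have hFc : Continuous F := hf.comp (continuous_mulSingle_mul_left e U)
  have hwc : Continuous fun h => Real.exp (-(t * F h)) := by fun_prop
  -- integrability of everything in sight (bounded continuous on a compact group)
  have hi : ∀ {g : G → ℝ}, Continuous g → Integrable g ν := fun hg =>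
    (BoundedContinuousFunction.mkOfCompact ⟨_, hg⟩).integrable _
  have hZpos : 0 < Z := integral_exp_pos (μ := ν) (f := fun h => -(t * F h)) (hi hwc)
  -- the orthogonal split `∫ (F + K)² w = ∫ (F − m)² w + (m + K)² Z` (cross term vanishes)
  have hcross : ∫ h, (F h - m) * Real.exp (-(t * F h)) ∂ν = 0 := by
    have h1 : ∫ h, (F h - m) * Real.exp (-(t * F h)) ∂ν =
        ∫ h, F h * Real.exp (-(t * F h)) ∂ν - m * Z := by
      have : ∀ h, (F h - m) * Real.exp (-(t * F h)) =
          F h * Real.exp (-(t * F h)) - m * Real.exp (-(t * F h)) := fun h => by ring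
      simp_rw [this]
      rw [integral_sub (hi (by fun_prop : Continuous fun h => F h * Real.exp (-(t * F h))))
        (hi (by fun_prop : Continuous fun h => m * Real.exp (-(t * F h)))), integral_const_mul]
    rw [h1]
    show ∫ h, F h * Real.exp (-(t * F h)) ∂ν -
      (∫ h, F h * Real.exp (-(t * F h)) ∂ν) / Z * Z = 0
    rw [div_mul_cancel₀ _ hZpos.ne', sub_self]
  have hsplit : ∫ h, (F h + K) ^ 2 * Real.exp (-(t * F h)) ∂ν =
      ∫ h, (F h - m) ^ 2 * Real.exp (-(t * F h)) ∂ν + (m + K) ^ 2 * Z := by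
    have : ∀ h, (F h + K) ^ 2 * Real.exp (-(t * F h)) =
        (F h - m) ^ 2 * Real.exp (-(t * F h)) +
          (2 * (m + K) * ((F h - m) * Real.exp (-(t * F h))) + (m + K) ^ 2 * Real.exp (-(t * F h))) :=
      fun h => by ring
    simp_rw [this]
    rw [integral_add (hi (by fun_prop : Continuous fun h => (F h - m) ^ 2 * Real.exp (-(t * F h))))
        (hi (by fun_prop : Continuous fun h => 2 * (m + K) * ((F h - m) * Real.exp (-(t * F h))) +
          (m + K) ^ 2 * Real.exp (-(t * F h)))),
      integral_add (hi (by fun_prop : Continuous fun h => 2 * (m + K) * ((F h - m) * Real.exp (-(t * F h)))))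
        (hi (by fun_prop : Continuous fun h => (m + K) ^ 2 * Real.exp (-(t * F h)))),
      integral_const_mul, hcross, mul_zero, zero_add, integral_const_mul]
  -- the weight dominates `e^{-|t|B} Z` pointwise, and `∫ (F − m)² dν ≥ Var_ν(F)`
  have hdom : ∀ h, Real.exp (-(|t| * B)) * Z ≤ Real.exp (-(t * F h)) := fun h =>
    exp_neg_mul_ge_exp_mul_integral ν (g := F) (fun y y' => hB _ _) h
  have hmain : Real.exp (-(|t| * B)) * Z * variance F ν ≤
      ∫ h, (F h - m) ^ 2 * Real.exp (-(t * F h)) ∂ν := by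
    calc Real.exp (-(|t| * B)) * Z * variance F ν
        ≤ Real.exp (-(|t| * B)) * Z * ∫ h, (F h - m) ^ 2 ∂ν :=
          mul_le_mul_of_nonneg_left (variance_le_integral_sq_sub ν hFc m)
            (mul_nonneg (Real.exp_nonneg _) hZpos.le)
      _ = ∫ h, Real.exp (-(|t| * B)) * Z * (F h - m) ^ 2 ∂ν := (integral_const_mul _ _).symm
      _ ≤ ∫ h, (F h - m) ^ 2 * Real.exp (-(t * F h)) ∂ν := by
          refine integral_mono (hi (by fun_prop : Continuous fun h => Real.exp (-(|t| * B)) * Z * (F h - m) ^ 2))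
            (hi (by fun_prop : Continuous fun h => (F h - m) ^ 2 * Real.exp (-(t * F h)))) fun h => ?_
          have := hdom h
          have h0 : 0 ≤ (F h - m) ^ 2 := sq_nonneg _
          nlinarith
  rw [hsplit]
  nlinarith [hmain]

/-- **The tilted fibre mean `m_e(U) = (∫ f(h ·_e U) e^{-t f(h ·_e U)} dν) / ∫ e^{-t f(h ·_e U)} dν` is
continuous in `U`** (parametric integrals of continuous functions on a compact group). [folklore] -/
theorem continuous_fibreTiltMean (e : Edge d L) (t : ℝ) {f : GaugeConfig d L G → ℝ} (hf : Continuous f) :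
    Continuous fun U : GaugeConfig d L G =>
      (∫ h, f (Pi.mulSingle e h * U) * Real.exp (-(t * f (Pi.mulSingle e h * U))) ∂(haarProbability G)) /
        ∫ h, Real.exp (-(t * f (Pi.mulSingle e h * U))) ∂(haarProbability G) := by
  have hg2 : Continuous fun q : GaugeConfig d L G × G => (Pi.mulSingle e q.2 : GaugeConfig d L G) * q.1 :=
    ((continuous_mulSingle_link (d := d) (L := L) e).comp continuous_snd).mul continuous_fst
  have hF : Continuous fun q : GaugeConfig d L G × G => f (Pi.mulSingle e q.2 * q.1) := hf.comp hg2
  refine (continuous_integral_param (haarProbability G)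
    (F := fun U h => f (Pi.mulSingle e h * U) * Real.exp (-(t * f (Pi.mulSingle e h * U)))) ?_).div
    (continuous_integral_param (haarProbability G)
      (F := fun U h => Real.exp (-(t * f (Pi.mulSingle e h * U)))) ?_) fun U => ?_
  · show Continuous fun q : GaugeConfig d L G × G =>
      f (Pi.mulSingle e q.2 * q.1) * Real.exp (-(t * f (Pi.mulSingle e q.2 * q.1)))
    exact hF.mul (Real.continuous_exp.comp ((continuous_const.mul hF).neg))
  · show Continuous fun q : GaugeConfig d L G × G => Real.exp (-(t * f (Pi.mulSingle e q.2 * q.1)))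
    exact Real.continuous_exp.comp ((continuous_const.mul hF).neg)
  · have hc : Continuous fun h : G => Real.exp (-(t * f (Pi.mulSingle e h * U))) :=
      Real.continuous_exp.comp ((continuous_const.mul (hf.comp (continuous_mulSingle_mul_left e U))).neg)
    have hi : Integrable (fun h : G => Real.exp (-(t * f (Pi.mulSingle e h * U)))) (haarProbability G) :=
      (BoundedContinuousFunction.mkOfCompact ⟨_, hc⟩).integrable _
    exact (integral_exp_pos hi).ne'

omit [NeZero L] [SecondCountableTopology G] in
/-- **The tilted fibre mean along `e` is invariant along every OTHER fibre `e'` along which `f` is**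
(the two fibre moves commute). [ours] -/
theorem fibreTiltMean_invariant {e e' : Edge d L} (hne : e' ≠ e) (t : ℝ) {f : GaugeConfig d L G → ℝ}
    (hinv : ∀ (k : G) (U : GaugeConfig d L G), f (Pi.mulSingle e' k * U) = f U) (k : G)
    (U : GaugeConfig d L G) :
    (∫ h, f (Pi.mulSingle e h * (Pi.mulSingle e' k * U)) *
        Real.exp (-(t * f (Pi.mulSingle e h * (Pi.mulSingle e' k * U)))) ∂(haarProbability G)) /
        ∫ h, Real.exp (-(t * f (Pi.mulSingle e h * (Pi.mulSingle e' k * U)))) ∂(haarProbability G) =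
      (∫ h, f (Pi.mulSingle e h * U) * Real.exp (-(t * f (Pi.mulSingle e h * U))) ∂(haarProbability G)) /
        ∫ h, Real.exp (-(t * f (Pi.mulSingle e h * U))) ∂(haarProbability G) := by
  have hcomm : ∀ h : G, Pi.mulSingle e h * (Pi.mulSingle e' k * U) =
      Pi.mulSingle e' k * (Pi.mulSingle e h * U) := fun h => by
    have h0 : (Pi.mulSingle e h : GaugeConfig d L G) * Pi.mulSingle e' k = Pi.mulSingle e' k * Pi.mulSingle e h :=
      (Pi.mulSingle_commute (f := fun _ : Edge d L => G) hne.symm h k).eq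
    rw [← mul_assoc, ← mul_assoc, h0]
  simp only [hcomm, hinv]

/-- **The Haar fibre variance `U ↦ Var_ν[h ↦ f(h ·_e U)]` of a continuous `f` is continuous** (it is
`∫ F² dν − (∫ F dν)²`, two parametric integrals). [folklore] -/
theorem continuous_fibreVariance (e : Edge d L) {f : GaugeConfig d L G → ℝ} (hf : Continuous f) :
    Continuous fun U : GaugeConfig d L G => variance (fun h => f (Pi.mulSingle e h * U)) (haarProbability G) := by
  have hg2 : Continuous fun q : GaugeConfig d L G × G => (Pi.mulSingle e q.2 : GaugeConfig d L G) * q.1 :=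
    ((continuous_mulSingle_link (d := d) (L := L) e).comp continuous_snd).mul continuous_fst
  have hF : Continuous fun q : GaugeConfig d L G × G => f (Pi.mulSingle e q.2 * q.1) := hf.comp hg2
  have hVeq : ∀ U : GaugeConfig d L G, variance (fun h => f (Pi.mulSingle e h * U)) (haarProbability G) =
      (∫ h, f (Pi.mulSingle e h * U) ^ 2 ∂(haarProbability G)) -
        (∫ h, f (Pi.mulSingle e h * U) ∂(haarProbability G)) ^ 2 := by
    intro U
    have hFcU : Continuous fun h : G => f (Pi.mulSingle e h * U) := hf.comp (continuous_mulSingle_mul_left e U)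
    obtain ⟨C, hC⟩ : ∃ C, ∀ h : G, ‖f (Pi.mulSingle e h * U)‖ ≤ C :=
      ⟨_, (BoundedContinuousFunction.mkOfCompact ⟨_, hFcU⟩).norm_coe_le_norm⟩
    have hmem : MemLp (fun h : G => f (Pi.mulSingle e h * U)) 2 (haarProbability G) :=
      MemLp.of_bound hFcU.aestronglyMeasurable C (ae_of_all _ hC)
    rw [variance_eq_sub hmem]
    rfl
  rw [show (fun U : GaugeConfig d L G => variance (fun h => f (Pi.mulSingle e h * U)) (haarProbability G)) =
      fun U => (∫ h, f (Pi.mulSingle e h * U) ^ 2 ∂(haarProbability G)) -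
        (∫ h, f (Pi.mulSingle e h * U) ∂(haarProbability G)) ^ 2 from funext hVeq]
  refine (continuous_integral_param (haarProbability G) (F := fun U h => f (Pi.mulSingle e h * U) ^ 2) ?_).sub
    ((continuous_integral_param (haarProbability G) (F := fun U h => f (Pi.mulSingle e h * U)) ?_).pow 2)
  · rw [Function.uncurry_def]; exact hF.pow 2
  · rw [Function.uncurry_def]; exact hF

/-- **THE ONE-LINK STEP.**  `S, f, c` continuous on `G^E`; `S − f` and `c` invariant along the `e`-fibre
(`r(h ·_e U) = r(U)`); `osc f ≤ B`.  Then for every real `t`, with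
`m_e(U) = (∫ f(h ·_e U) e^{-t f(h ·_e U)} dν(h)) / ∫ e^{-t f(h ·_e U)} dν(h)` and `c' = f + c − m_e`:
`e^{-|t|B} ∫ e^{-tS(U)} Var_ν[h ↦ f(h ·_e U)] dD(U) + ∫ (S − c')² e^{-tS} dD ≤ ∫ (S − c)² e^{-tS} dD`. [ours] -/
theorem one_link_step (e : Edge d L) (t B : ℝ) {S f c : GaugeConfig d L G → ℝ} (hS : Continuous S)
    (hf : Continuous f) (hc : Continuous c)
    (hr : ∀ (h : G) (U : GaugeConfig d L G), S (Pi.mulSingle e h * U) - f (Pi.mulSingle e h * U) = S U - f U)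
    (hcinv : ∀ (h : G) (U : GaugeConfig d L G), c (Pi.mulSingle e h * U) = c U)
    (hB : ∀ U V, f U - f V ≤ B) :
    let ν := haarProbability G
    let m : GaugeConfig d L G → ℝ := fun U =>
      (∫ h, f (Pi.mulSingle e h * U) * Real.exp (-(t * f (Pi.mulSingle e h * U))) ∂ν) /
        ∫ h, Real.exp (-(t * f (Pi.mulSingle e h * U))) ∂ν
    Real.exp (-(|t| * B)) * ∫ U, Real.exp (-(t * S U)) *
        variance (fun h => f (Pi.mulSingle e h * U)) ν ∂(trivialMeasure G d L) +
      ∫ U, (S U - (f U + c U - m U)) ^ 2 * Real.exp (-(t * S U)) ∂(trivialMeasure G d L) ≤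
    ∫ U, (S U - c U) ^ 2 * Real.exp (-(t * S U)) ∂(trivialMeasure G d L) := by
  intro ν m
  set D := trivialMeasure G d L with hD
  haveI : IsProbabilityMeasure D := trivialMeasure_isProbabilityMeasure
  haveI : ν.IsMulRightInvariant := by show (haarProbability G).IsMulRightInvariant; infer_instance
  -- shorthand: the fibre function, its tilted partition function / first moment, the fibre variance
  set F : GaugeConfig d L G → G → ℝ := fun U h => f (Pi.mulSingle e h * U) with hFdef
  set Z : GaugeConfig d L G → ℝ := fun U => ∫ h, Real.exp (-(t * F U h)) ∂ν with hZdef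
  set P : GaugeConfig d L G → ℝ := fun U => ∫ h, F U h * Real.exp (-(t * F U h)) ∂ν with hPdef
  set V : GaugeConfig d L G → ℝ := fun U => variance (F U) ν with hVdef
  have hm : ∀ U, m U = P U / Z U := fun U => rfl
  -- joint continuity of `(U, h) ↦ F U h`
  have hg2 : Continuous fun q : GaugeConfig d L G × G => (Pi.mulSingle e q.2 : GaugeConfig d L G) * q.1 :=
    ((continuous_mulSingle_link (d := d) (L := L) e).comp continuous_snd).mul continuous_fst
  have hFc : Continuous (Function.uncurry F) := by
    show Continuous fun q : GaugeConfig d L G × G => f (Pi.mulSingle e q.2 * q.1)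
    exact hf.comp hg2
  have hFcU : ∀ U, Continuous (F U) := fun U => hf.comp (continuous_mulSingle_mul_left e U)
  have hi : ∀ {g : G → ℝ}, Continuous g → Integrable g ν := fun hg =>
    (BoundedContinuousFunction.mkOfCompact ⟨_, hg⟩).integrable _
  -- continuity in `U` of `Z`, `P`, `∫ F²`, `∫ F`, hence of `m` and `V`
  have hexpc : Continuous (Function.uncurry fun U h => Real.exp (-(t * F U h))) := by
    show Continuous fun q : GaugeConfig d L G × G => Real.exp (-(t * Function.uncurry F q))
    fun_prop
  have hZc : Continuous Z := continuous_integral_param ν (F := fun U h => Real.exp (-(t * F U h))) hexpc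
  have hPc : Continuous P := continuous_integral_param ν
    (F := fun U h => F U h * Real.exp (-(t * F U h)))
    (by
      show Continuous fun q : GaugeConfig d L G × G =>
        Function.uncurry F q * Real.exp (-(t * Function.uncurry F q))
      fun_prop)
  have hZpos : ∀ U, 0 < Z U := fun U =>
    integral_exp_pos (μ := ν) (f := fun h => -(t * F U h)) (hi (by
      show Continuous fun h => Real.exp (-(t * F U h))
      exact Real.continuous_exp.comp ((continuous_const.mul (hFcU U)).neg)))
  have hmc : Continuous m := continuous_fibreTiltMean e t hf
  have hVc : Continuous V := continuous_fibreVariance e hf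
  -- invariance along the fibre: `F (h₀ ·_e U) h = F U (h h₀)`, hence `Z, P, m, V` are fibre-invariant
  have hFfib : ∀ (h₀ h : G) (U : GaugeConfig d L G), F (Pi.mulSingle e h₀ * U) h = F U (h * h₀) :=
    fun h₀ h U => by simp only [hFdef, mulSingle_mul_mulSingle_mul]
  have hZfib : ∀ (h₀ : G) U, Z (Pi.mulSingle e h₀ * U) = Z U := fun h₀ U => by
    simp only [hZdef, hFfib]
    exact integral_mul_right_eq_self (μ := ν) (fun h => Real.exp (-(t * F U h))) h₀
  have hPfib : ∀ (h₀ : G) U, P (Pi.mulSingle e h₀ * U) = P U := fun h₀ U => by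
    simp only [hPdef, hFfib]
    exact integral_mul_right_eq_self (μ := ν) (fun h => F U h * Real.exp (-(t * F U h))) h₀
  have hmfib : ∀ (h₀ : G) U, m (Pi.mulSingle e h₀ * U) = m U := fun h₀ U => by
    rw [hm, hm, hZfib, hPfib]
  have hVfib : ∀ (h₀ : G) U, V (Pi.mulSingle e h₀ * U) = V U := fun h₀ U => by
    simp only [hVdef]
    have hfun : F (Pi.mulSingle e h₀ * U) = fun h => F U (h * h₀) := funext (hFfib h₀ · U)
    rw [hfun]
    exact (measurePreserving_mul_right ν h₀).variance_fun_comp (hFcU U).aemeasurable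
  -- along the fibre `S = F + r`, `r := S − f`
  have hSfib : ∀ (h : G) (U : GaugeConfig d L G),
      S (Pi.mulSingle e h * U) = F U h + (S U - f U) := fun h U => by
    have := hr h U; simp only [hFdef]; linarith
  -- (a) the three fibre averages
  have hw : Continuous fun U => Real.exp (-(t * S U)) := by fun_prop
  have hA := integral_eq_integral_fibre (G := G) e
    (Φ := fun U => (S U - c U) ^ 2 * Real.exp (-(t * S U))) (by fun_prop)
  have hBint := integral_eq_integral_fibre (G := G) e
    (Φ := fun U => Real.exp (-(t * S U)) * V U) (hw.mul hVc)
  have hCint := integral_eq_integral_fibre (G := G) e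
    (Φ := fun U => (S U - (f U + c U - m U)) ^ 2 * Real.exp (-(t * S U))) (by fun_prop)
  -- (b) evaluate the inner integrals
  have hinnerB : ∀ U, ∫ h, Real.exp (-(t * S (Pi.mulSingle e h * U))) * V (Pi.mulSingle e h * U) ∂ν =
      Real.exp (-(t * (S U - f U))) * Z U * V U := by
    intro U
    simp only [hVfib, hSfib]
    have : ∀ h, Real.exp (-(t * (F U h + (S U - f U)))) * V U =
        Real.exp (-(t * (S U - f U))) * V U * Real.exp (-(t * F U h)) := fun h => by
      rw [show -(t * (F U h + (S U - f U))) = -(t * (S U - f U)) + -(t * F U h) by ring, Real.exp_add]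
      ring
    simp_rw [this]
    rw [integral_const_mul]
    simp only [hZdef]; ring
  have hinnerC : ∀ U, ∫ h, (S (Pi.mulSingle e h * U) - (f (Pi.mulSingle e h * U) + c (Pi.mulSingle e h * U) -
      m (Pi.mulSingle e h * U))) ^ 2 * Real.exp (-(t * S (Pi.mulSingle e h * U))) ∂ν =
      Real.exp (-(t * (S U - f U))) * Z U * (m U + ((S U - f U) - c U)) ^ 2 := by
    intro U
    simp only [hmfib, hcinv, hSfib]
    have : ∀ h, (F U h + (S U - f U) - (f (Pi.mulSingle e h * U) + c U - m U)) ^ 2 *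
        Real.exp (-(t * (F U h + (S U - f U)))) =
        Real.exp (-(t * (S U - f U))) * (m U + ((S U - f U) - c U)) ^ 2 * Real.exp (-(t * F U h)) := by
      intro h
      rw [show -(t * (F U h + (S U - f U))) = -(t * (S U - f U)) + -(t * F U h) by ring, Real.exp_add]
      simp only [hFdef]; ring
    simp_rw [this]
    rw [integral_const_mul]
    simp only [hZdef]; ring
  have hinnerA : ∀ U, Real.exp (-(t * (S U - f U))) *
      (Real.exp (-(|t| * B)) * Z U * V U + Z U * (m U + ((S U - f U) - c U)) ^ 2) ≤
      ∫ h, (S (Pi.mulSingle e h * U) - c (Pi.mulSingle e h * U)) ^ 2 *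
        Real.exp (-(t * S (Pi.mulSingle e h * U))) ∂ν := by
    intro U
    have key := fibre_sq_integral_ge (G := G) e t B ((S U - f U) - c U) hf hB U
    simp only at key
    simp only [hcinv, hSfib]
    have : ∀ h, (F U h + (S U - f U) - c U) ^ 2 * Real.exp (-(t * (F U h + (S U - f U)))) =
        Real.exp (-(t * (S U - f U))) *
          ((F U h + ((S U - f U) - c U)) ^ 2 * Real.exp (-(t * F U h))) := by
      intro h
      rw [show -(t * (F U h + (S U - f U))) = -(t * (S U - f U)) + -(t * F U h) by ring, Real.exp_add]
      ring
    simp_rw [this]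
    rw [integral_const_mul]
    exact mul_le_mul_of_nonneg_left key (Real.exp_nonneg _)
  -- (c) integrate (b) over `U` and assemble
  have hIa : Integrable (fun U => Real.exp (-(t * (S U - f U))) * Z U * V U) D :=
    (BoundedContinuousFunction.mkOfCompact ⟨_, ((by fun_prop : Continuous fun U =>
      Real.exp (-(t * (S U - f U)))).mul hZc).mul hVc⟩).integrable _
  have hIb : Integrable (fun U => Real.exp (-(t * (S U - f U))) * Z U * (m U + ((S U - f U) - c U)) ^ 2) D :=
    (BoundedContinuousFunction.mkOfCompact ⟨_, ((by fun_prop : Continuous fun U =>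
      Real.exp (-(t * (S U - f U)))).mul hZc).mul ((hmc.add ((hS.sub hf).sub hc)).pow 2)⟩).integrable _
  have hrhsc : Continuous (Function.uncurry fun (U : GaugeConfig d L G) (h : G) =>
      (S (Pi.mulSingle e h * U) - c (Pi.mulSingle e h * U)) ^ 2 *
        Real.exp (-(t * S (Pi.mulSingle e h * U)))) := by
    have hSg : Continuous fun q : GaugeConfig d L G × G => S (Pi.mulSingle e q.2 * q.1) := hS.comp hg2
    have hcg : Continuous fun q : GaugeConfig d L G × G => c (Pi.mulSingle e q.2 * q.1) := hc.comp hg2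
    show Continuous fun q : GaugeConfig d L G × G =>
      (S (Pi.mulSingle e q.2 * q.1) - c (Pi.mulSingle e q.2 * q.1)) ^ 2 *
        Real.exp (-(t * S (Pi.mulSingle e q.2 * q.1)))
    exact ((hSg.sub hcg).pow 2).mul (Real.continuous_exp.comp ((continuous_const.mul hSg).neg))
  have hIrhs : Integrable (fun U => ∫ h, (S (Pi.mulSingle e h * U) - c (Pi.mulSingle e h * U)) ^ 2 *
      Real.exp (-(t * S (Pi.mulSingle e h * U))) ∂ν) D :=
    (BoundedContinuousFunction.mkOfCompact ⟨_, continuous_integral_param ν hrhsc⟩).integrable _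
  have hsum : Real.exp (-(|t| * B)) * ∫ U, Real.exp (-(t * (S U - f U))) * Z U * V U ∂D +
      ∫ U, Real.exp (-(t * (S U - f U))) * Z U * (m U + ((S U - f U) - c U)) ^ 2 ∂D ≤
      ∫ U, ∫ h, (S (Pi.mulSingle e h * U) - c (Pi.mulSingle e h * U)) ^ 2 *
        Real.exp (-(t * S (Pi.mulSingle e h * U))) ∂ν ∂D := by
    rw [← integral_const_mul, ← integral_add (hIa.const_mul _) hIb]
    refine integral_mono ((hIa.const_mul _).add hIb) hIrhs fun U => ?_
    have := hinnerA U
    nlinarith [this, Real.exp_nonneg (-(t * (S U - f U)))]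
  -- rewrite the three terms
  have hT1 : ∫ U, Real.exp (-(t * S U)) * V U ∂D = ∫ U, Real.exp (-(t * (S U - f U))) * Z U * V U ∂D := by
    rw [hBint]; exact integral_congr_ae (ae_of_all _ fun U => hinnerB U)
  have hT2 : ∫ U, (S U - (f U + c U - m U)) ^ 2 * Real.exp (-(t * S U)) ∂D =
      ∫ U, Real.exp (-(t * (S U - f U))) * Z U * (m U + ((S U - f U) - c U)) ^ 2 ∂D := by
    rw [hCint]; exact integral_congr_ae (ae_of_all _ fun U => hinnerC U)
  show Real.exp (-(|t| * B)) * ∫ U, Real.exp (-(t * S U)) * V U ∂D +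
      ∫ U, (S U - (f U + c U - m U)) ^ 2 * Real.exp (-(t * S U)) ∂D ≤
    ∫ U, (S U - c U) ^ 2 * Real.exp (-(t * S U)) ∂D
  rw [hT1, hT2, hA]
  exact hsum

end OneLink

end Summit.Ventures.LatticeQCDFlow.TrivializingMaps
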